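import Mathlib
import Summits.NavierStokesRegularity.NavierStokesRegularity.Theorems.EulerZoomLiouvillePowerGaugeEulerLiouvilleSteady
import Literature.Analysis.FluidPDE.SelfSimilarCollapseAnsatz
import Literature.Analysis.FluidPDE.SuitableWeakCongr
import HarnessLib.Audit

/-!
# Rung C1 of the crux `EulerZoomLiouville.PowerGaugeEulerLiouville`: the HOMOGENEOUS-PROFILE (= STEADY) stratum of the
# exactly self-similar case is EMPTY in the class

Route №10 `EulerZoomLiouville` (NavierStokesRegularity), crux E = stmt-NavierStokesRegularity-19832, tenure rung C1,
registered residue `stub_selfSimilarExtremalRest`.  Lineage ns-typeII-p2 (gen 8, INTERIM LEAD-of-record of 19832),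
recording in the kernel the model-class finding of ns-typeII-critic-1 g12 (K-READ-lite of the lead's `disprover-wanted`,
memo `KREAD-lite-19832-DisproverWanted.md` sha16 67239f2153211d15 + probe `ProbeHomogeneous.lean`, evidence #41/#42 on
19832): the homogeneous `|y|^{1−1/γ}` profiles à la Chae–Shvydkoy / Shvydkoy (the v11/v12 census's «Shvydkoy's
homogeneous-profile conjecture sits here» sub-stratum of the weak class) carry NO refuting member, because such a member
is STEADY and steady members of the class vanish (`powerGaugeEulerLiouville_steady`, p-steady rung B).

* `selfSimilarCollapse_eq_of_homogeneous` — a critically homogeneous profile (`V(s y) = s^{−(1+ρ)} V(y)`, `s > 0`;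
  degree `1 − 1/γ` for `γ = 1/(2+ρ)`) makes the collapse ansatz time-independent: `u(τ, ·) = V` for `τ < 0`;
* `selfSimilar_ae_eq_zero_of_steadyProfile` — MEMBER LEVEL, crux hypotheses verbatim + exact self-similarity of the
  velocity: if `u(τ, ·) = V` for every `τ < 0` (the member is steady on the slab), then `u = 0` a.e. on
  `(−∞,0) × ℝ³` — transfer to the literally steady field `fun _ => V` by the a.e.-congruence of the class predicates
  (`IsSuitableWeakSolutionOn.congr_ae`, `HasWeakSpatialGradientOn.congr_ae`, `cknA` by `iSup_congr`) and rung B;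
* **`selfSimilar_ae_eq_zero_of_homogeneousProfile`** — hence an exactly self-similar member whose velocity profile is
  critically homogeneous vanishes: the homogeneous-profile stratum of `stub_selfSimilarExtremalRest` is FILLED
  (skeleton v14: hypothesis `¬ IsHomogeneousProfile ρ V` added to the open stub).

WHAT THIS IS NOT: not NS, not E, not rung C1 — one explicit family removed from the weak-class residue; Shvydkoy's
conjecture on homogeneous STEADY Euler solutions is not touched (the class's `E`-gauge is what kills steady members here).
[folklore; ChaeShvydkoy2013 §1 (homogeneous profiles as the borderline of the energy argument)]
-/

noncomputable section

-- flat `Theorems/<Route><Decl>…` files of one crux share the namespace of the crux (tree convention)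
set_option linter.dupNamespace false

open MeasureTheory Set Filter Topology Metric Function
open scoped NNReal ENNReal

namespace Summit.NavierStokesRegularity.NavierStokesRegularity.Theorems.PowerGaugeEulerLiouville.SteadyProfile

open Literature.Analysis Literature.Analysis.FluidPDE

/-- **A critically homogeneous profile makes the collapse ansatz steady**: if `V (s • y) = s^{−(1+ρ)} • V y` for all
`s > 0` (`ρ > 0`), then `selfSimilarCollapse (1/(2+ρ)) 0 V τ = V` for every `τ < 0` (the exponents
`(−τ)^{γ−1} · ((−τ)^{−γ})^{−(1+ρ)} = (−τ)^{γ−1+γ(1+ρ)} = 1`, `γ(2+ρ) = 1`).  After ns-typeII-critic-1 g12's probe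
`selfSimilar_member_steady_of_homogeneous`. [folklore] -/
theorem selfSimilarCollapse_eq_of_homogeneous {ρ : ℝ} (hρ : 0 < ρ)
    {V : EuclideanSpace ℝ (Fin 3) → EuclideanSpace ℝ (Fin 3)}
    (hV : ∀ s : ℝ, 0 < s → ∀ y, V (s • y) = s ^ (-(1 + ρ)) • V y) {τ : ℝ} (hτ : τ < 0) :
    selfSimilarCollapse (1 / (2 + ρ)) 0 V τ = V := by
  funext x
  have hpos : 0 < 0 - τ := by linarith
  have h2 : (2 + ρ) ≠ 0 := by positivity
  rw [selfSimilarCollapse_apply, hV _ (Real.rpow_pos_of_pos hpos _), smul_smul]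
  have : (0 - τ) ^ (1 / (2 + ρ) - 1) * ((0 - τ) ^ (-(1 / (2 + ρ)))) ^ (-(1 + ρ)) = 1 := by
    rw [← Real.rpow_mul hpos.le, ← Real.rpow_add hpos]
    have : 1 / (2 + ρ) - 1 + -(1 / (2 + ρ)) * -(1 + ρ) = 0 := by field_simp; ring
    rw [this, Real.rpow_zero]
  rw [this, one_smul]

/-- **A class member that is steady on the slab vanishes** (crux hypotheses verbatim, any `ρ > 0`): if
`u(τ, ·) = V` for every `τ < 0` then `u = 0` a.e. on `(−∞,0) × ℝ³`.  The class predicates see `u` only on the slab, so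
they transfer to the literally steady field `fun _ => V` (`IsSuitableWeakSolutionOn.congr_ae`,
`HasWeakSpatialGradientOn.congr_ae`; `cknA` by `iSup_congr` over `t ∈ (−a², 0)`; `cknE`, `cknD` unchanged), which vanishes by
rung B `powerGaugeEulerLiouville_steady` (`E`-gauge ⇒ zero weak gradient ⇒ constant ⇒ `A`-gauge). [folklore] -/
theorem selfSimilar_ae_eq_zero_of_steadyProfile {ρ : ℝ} (hρ : 0 < ρ)
    {u : ℝ → EuclideanSpace ℝ (Fin 3) → EuclideanSpace ℝ (Fin 3)} {p : ℝ → EuclideanSpace ℝ (Fin 3) → ℝ}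
    {H : ℝ → EuclideanSpace ℝ (Fin 3) → EuclideanSpace ℝ (Fin 3) →L[ℝ] EuclideanSpace ℝ (Fin 3)} {c : ℝ≥0}
    (hsw : IsSuitableWeakSolutionOn (slab (EuclideanSpace ℝ (Fin 3)) (Iio 0) isOpen_Iio) 0 0 u p)
    (hH : HasWeakSpatialGradientOn (slab (EuclideanSpace ℝ (Fin 3)) (Iio 0) isOpen_Iio) u H)
    (hgauge : ∀ a : ℝ, 0 < a →
      ENNReal.ofReal (a ^ (2 * ρ)) * cknA a (0 : ℝ × EuclideanSpace ℝ (Fin 3)) u +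
          ENNReal.ofReal (a ^ ρ) * cknE a (0 : ℝ × EuclideanSpace ℝ (Fin 3)) H +
        ENNReal.ofReal (a ^ (2 * ρ)) * cknD a (0 : ℝ × EuclideanSpace ℝ (Fin 3)) p ≤ (c : ℝ≥0∞))
    {V : EuclideanSpace ℝ (Fin 3) → EuclideanSpace ℝ (Fin 3)} (hsteady : ∀ τ : ℝ, τ < 0 → u τ = V) :
    uncurry u =ᵐ[volume.restrict (Iio (0 : ℝ) ×ˢ (univ : Set (EuclideanSpace ℝ (Fin 3))))] 0 := by
  -- `u` and the steady field agree pointwise on the slab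
  have hslab : ∀ z ∈ (Iio (0 : ℝ) ×ˢ (univ : Set (EuclideanSpace ℝ (Fin 3)))),
      uncurry u z = uncurry (fun _ : ℝ => V) z := by
    rintro ⟨τ, x⟩ ⟨hτ, -⟩
    simp only [uncurry, hsteady τ hτ]
  have hS : MeasurableSet (Iio (0 : ℝ) ×ˢ (univ : Set (EuclideanSpace ℝ (Fin 3)))) :=
    measurableSet_Iio.prod MeasurableSet.univ
  have hae : ∀ᵐ z ∂(volume.restrict ((slab (EuclideanSpace ℝ (Fin 3)) (Iio 0) isOpen_Iio :
      TopologicalSpace.Opens (ℝ × EuclideanSpace ℝ (Fin 3))) : Set (ℝ × EuclideanSpace ℝ (Fin 3)))),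
      uncurry u z = uncurry (fun _ : ℝ => V) z := by
    have : ((slab (EuclideanSpace ℝ (Fin 3)) (Iio 0) isOpen_Iio :
        TopologicalSpace.Opens (ℝ × EuclideanSpace ℝ (Fin 3))) : Set (ℝ × EuclideanSpace ℝ (Fin 3))) =
        Iio (0 : ℝ) ×ˢ (univ : Set (EuclideanSpace ℝ (Fin 3))) := by
      simp [slab]
    rw [this]
    exact (ae_restrict_mem hS).mono hslab
  have hp : ∀ᵐ z ∂(volume.restrict ((slab (EuclideanSpace ℝ (Fin 3)) (Iio 0) isOpen_Iio :
      TopologicalSpace.Opens (ℝ × EuclideanSpace ℝ (Fin 3))) : Set (ℝ × EuclideanSpace ℝ (Fin 3)))),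
      uncurry p z = uncurry p z := Eventually.of_forall fun _ => rfl
  -- transfer of the class predicates
  have hsw' := hsw.congr_ae hae hp
  have hH' := hH.congr_ae hae
  have hA : ∀ a : ℝ, cknA a (0 : ℝ × EuclideanSpace ℝ (Fin 3)) (fun _ : ℝ => V) =
      cknA a (0 : ℝ × EuclideanSpace ℝ (Fin 3)) u := by
    intro a
    unfold cknA
    refine iSup_congr fun t => iSup_congr fun ht => ?_
    have ht0 : t < 0 := by simpa using ht.2
    rw [hsteady t ht0]
  have hgauge' : ∀ a : ℝ, 0 < a →
      ENNReal.ofReal (a ^ (2 * ρ)) * cknA a (0 : ℝ × EuclideanSpace ℝ (Fin 3)) (fun _ : ℝ => V) +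
          ENNReal.ofReal (a ^ ρ) * cknE a (0 : ℝ × EuclideanSpace ℝ (Fin 3)) H +
        ENNReal.ofReal (a ^ (2 * ρ)) * cknD a (0 : ℝ × EuclideanSpace ℝ (Fin 3)) p ≤ (c : ℝ≥0∞) := by
    intro a ha; rw [hA a]; exact hgauge a ha
  have hzero := powerGaugeEulerLiouville_steady ρ hρ V p H c hsw' hH' hgauge'
  -- back to `u`
  have hae' : uncurry u =ᵐ[volume.restrict (Iio (0 : ℝ) ×ˢ (univ : Set (EuclideanSpace ℝ (Fin 3))))]
      uncurry (fun _ : ℝ => V) := (ae_restrict_mem hS).mono hslab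
  exact hae'.trans hzero

/-- **THE HOMOGENEOUS-PROFILE STRATUM OF `stub_selfSimilarExtremalRest` IS EMPTY** (crux hypotheses verbatim, any `ρ > 0`):
an exactly self-similar member `u(τ) = selfSimilarCollapse (1/(2+ρ)) 0 V τ` whose velocity profile is critically
homogeneous, `V (s • y) = s^{−(1+ρ)} • V y` (`s > 0`) — the `|y|^{1−1/γ}`-homogeneous candidates of the weak class — is
steady on the slab, hence `u = 0` a.e.  (ns-typeII-critic-1 g12's model-class finding, kernel form.) [folklore] -/
theorem selfSimilar_ae_eq_zero_of_homogeneousProfile {ρ : ℝ} (hρ : 0 < ρ)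
    {u : ℝ → EuclideanSpace ℝ (Fin 3) → EuclideanSpace ℝ (Fin 3)} {p : ℝ → EuclideanSpace ℝ (Fin 3) → ℝ}
    {H : ℝ → EuclideanSpace ℝ (Fin 3) → EuclideanSpace ℝ (Fin 3) →L[ℝ] EuclideanSpace ℝ (Fin 3)} {c : ℝ≥0}
    (hsw : IsSuitableWeakSolutionOn (slab (EuclideanSpace ℝ (Fin 3)) (Iio 0) isOpen_Iio) 0 0 u p)
    (hH : HasWeakSpatialGradientOn (slab (EuclideanSpace ℝ (Fin 3)) (Iio 0) isOpen_Iio) u H)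
    (hgauge : ∀ a : ℝ, 0 < a →
      ENNReal.ofReal (a ^ (2 * ρ)) * cknA a (0 : ℝ × EuclideanSpace ℝ (Fin 3)) u +
          ENNReal.ofReal (a ^ ρ) * cknE a (0 : ℝ × EuclideanSpace ℝ (Fin 3)) H +
        ENNReal.ofReal (a ^ (2 * ρ)) * cknD a (0 : ℝ × EuclideanSpace ℝ (Fin 3)) p ≤ (c : ℝ≥0∞))
    {V : EuclideanSpace ℝ (Fin 3) → EuclideanSpace ℝ (Fin 3)}
    (hu : ∀ τ : ℝ, τ < 0 → u τ = selfSimilarCollapse (1 / (2 + ρ)) 0 V τ)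
    (hV : ∀ s : ℝ, 0 < s → ∀ y, V (s • y) = s ^ (-(1 + ρ)) • V y) :
    uncurry u =ᵐ[volume.restrict (Iio (0 : ℝ) ×ˢ (univ : Set (EuclideanSpace ℝ (Fin 3))))] 0 :=
  selfSimilar_ae_eq_zero_of_steadyProfile hρ hsw hH hgauge fun τ hτ => by
    rw [hu τ hτ, selfSimilarCollapse_eq_of_homogeneous hρ hV hτ]

end Summit.NavierStokesRegularity.NavierStokesRegularity.Theorems.PowerGaugeEulerLiouville.SteadyProfile

end
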